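import Summits.BirchSwinnertonDyer.BirchSwinnertonDyer.Theorems.GenusKolyvaginAtTwoGenusPrimitiveSupplyAtTwoDescentSignIffSha
import Summits.BirchSwinnertonDyer.BirchSwinnertonDyer.Theorems.GenusKolyvaginAtTwoGenusPrimitiveSupplyAtTwoPrimeTwistEggBitFiniteSha
import Summits.BirchSwinnertonDyer.BirchSwinnertonDyer.Theorems.GenusKolyvaginAtTwoCasselsTateNumberField
import HarnessLib

/-!
# Route `GenusKolyvaginAtTwo`, crux #2 `GenusPrimitiveSupplyAtTwo` (stmt-BirchSwinnertonDyer-22136):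
# `ε(E) = −1`: THE `2`-SELMER GROUP OF `E` OVER AN ADMISSIBLE IMAGINARY QUADRATIC FIELD HAS ORDER `4` OR `8` —
# the `𝔽₂[Gal(K/ℚ)]`-structure of `Sel₂(E_K/K)`, and DESC-28-G′ up to one bit

Width seat `bsd-line-gk2-p5` g17 (cell `bsd-f1-sign2`, SUPPLY lineage of crux 22136), file 51 of the series; sequel of file 50 (AN-10K⁼ and
DESC-28-G BY NAME; `Sel₂(E_K/K)^{Gal} = res_K Sel₂^{rel ∞}(E)`). THEOREMS ONLY (no definition, no named fact, no `sorry`, no local instance); helper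
`--supports stmt-BirchSwinnertonDyer-22136`; no item is closed; BSD is not proved by any of this.

WHAT. On the `ε = −1` side of the cell's descent-sign dichotomy (`Δ > 0`, `E(ℚ)[2] = 0`, rank one, `Ш(E)[2] = 0`, `E(ℚ) ⊂ E⁰(ℝ)`), for `d`
descent-admissible and `K ∋ √d` quadratic — with NO hypothesis on `rank E^{(d)}` and NO finiteness:

* §213 `natCard_selmerGroup_kummerStrict_inl_eq_two_of_not_meetsEgg` — `#Sel₂^{str ∞}(E) = 2` (`#Sel₂^{rel ∞}(E) = 4`, file 29;
  `[rel : str] = #𝓛_∞ = 2`, file 28).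
* §214 **`natCard_selmerGroup_baseChange_two_eq_four_or_eq_eight_of_not_meetsEgg`** — **`#Sel₂(E_K/K) ∈ {4, 8}`**: the endomorphism
  `m ↦ m + σ₀m` of `M = Sel₂(E_K/K)` has kernel `M^{σ₀} = res_K Sel₂^{rel ∞}(E)` of order `4` (file 50
  `mem_selmerGroup_and_conjAct_eq_iff_exists_mem_relaxed`) and image inside `res_K Sel₂^{str ∞}(E)` of order `≤ 2`
  (`m + σ₀m = res_K(cor m)`, `cor m` trivial at `∞` by file 48 and in `Sel₂^{rel ∞}(E)` by file 49);
  `…_eq_eight_of_not_meetsEgg_of_rank_two` (`rank E^{(d)} = 2 ⟹ #Sel₂(E_K/K) = 8`, `Ш(E_K/K)[2] = 0`: descent count with `rank E(K) = 3`);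
  `…_eq_eight_of_not_meetsEgg_of_finite` (`rank E^{(d)} = 0` and `Ш(E_K/K)[2^∞]` finite ⟹ `#Sel₂(E_K/K) = 8`, `#Ш(E_K/K)[2] = 4`: Cassels–Tate
  square, gk2-p1's `GenusExact.CasselsTateNumberField.isSquare_natCard_sha_torsionBy_pow`); in `Ш`-currency
  `natCard_sha_two_baseChange_eq_two_or_eq_four_of_not_meetsEgg` (rank-`0` door: `#Ш(E_K/K)[2] ∈ {2, 4}`) and
  `natCard_sha_two_baseChange_eq_one_of_not_meetsEgg_of_rank_two` (rank-`2` door: `Ш(E_K/K)[2] = 0`).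
* §215 `fieldSelmerTwoCard_eq_four_or_eq_eight_of_not_meetsEgg` — -desc's DESC-28-G′ `F1Sign2.IdentityGeneratorDoorFieldSelmerCardAtTwo`
  («`#Sel₂(W/K) = 8`») UP TO ONE BIT under its exact hypotheses: `#Sel₂(W/K) ∈ {4, 8}`; the missing bit is `#Ш(W_K/K)[2] ≠ 2` at a rank-`0`
  door (Cassels–Tate / Kramer Thm. 2; automatic under finiteness) together with `rank W^{(d_K)} ≠ 1`; and
  `fieldSelmerTwoCard_eq_two_iff_meetsEgg` — at a rank-`0` door field, `#Sel₂(W/K) = 2 ⟺ E(ℚ)` meets the egg.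

Honest framing: Kramer 1981 Thm. 1 (the `Gal(K/ℚ)`-module structure of `S(E/K)`) at the `ε = −1` stratum, finiteness-free, with the archimedean
transfer of file 48 in place of the norm-index count; kernel-new; beyond-print theorem: no. Crux 22136 stays OPEN exactly at (U) 24947 ∧ (CONV₂)
19220/24948. BSD is not proved by any of this.

References: [Kramer1981] Thm. 1, Prop. 7, Thm. 2; [MazurRubin2010] Lemma 3.2; [SerreGaloisCohomology1997] I §2.4; [Cassels1962ArithmeticIV] §1.
-/

set_option linter.dupNamespace false -- tree convention: `Summit.BirchSwinnertonDyer.BirchSwinnertonDyer.Theorems` (summit = sub-problem)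
set_option autoImplicit false

noncomputable section

open scoped Classical

namespace Summit.BirchSwinnertonDyer.BirchSwinnertonDyer.Theorems.GenusKolyArch

open WeierstrassCurve NumberField IsDedekindDomain Field
open Literature.NumberTheory.EllipticCurves Literature.NumberTheory.GaloisRepresentations
open Summit.BirchSwinnertonDyer.Rank1Residual.F1Sign2 (selmerGroupRelaxedAtInfinityAtTwo DescAdmissible NoRationalTwoTorsion
  ShaTwoTrivial MeetsEgg)

/-! ## §213 `ε = −1`: the strict-at-`∞` Selmer group of `W` has order `2` -/

section Strict

open Summit.BirchSwinnertonDyer.Rank1Residual.X11b.KummerPT (kummerStrict)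

variable (W : WeierstrassCurve ℚ) [W.IsElliptic]

/-- **`#Sel₂^{str ∞}(E) = 2`** for `Δ > 0`, `E(ℚ)[2] = 0`, rank one, `Ш(E)[2] = 0`, `E(ℚ) ⊂ E⁰(ℝ)`: `#Sel₂^{rel ∞}(E) = 4` (file 29) and
`[Sel₂^{rel ∞} : Sel₂^{str ∞}] = #𝓛_∞ = 2` (file 28, Mazur–Rubin Lemma 3.2 at `T = {∞}`). [cite: MazurRubin2010, Lemma 3.2] [cite: Kramer1981, §2 Prop. 6] -/
theorem natCard_selmerGroup_kummerStrict_inl_eq_two_of_not_meetsEgg (hΔ : 0 < W.Δ) (hT : NoRationalTwoTorsion W)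
    (hrank : W.mordellWeilRank = 1) (hSha : ShaTwoTrivial W) (hegg : ¬ MeetsEgg W) :
    Nat.card ((kummerStrict W 2 {(Sum.inl Rat.infinitePlace : Place ℚ)}).selmerGroup) = 2 := by
  have h4 := natCard_selmerGroupRelaxedAtInfinityAtTwo_eq_four_of_not_meetsEgg W hΔ hT hrank hSha hegg
  have hidx := relIndex_kummerStrict_selmerGroupRelaxedAtInfinityAtTwo_eq_two_of_Δ_pos W hΔ Rat.infinitePlace
  have hle : (kummerStrict W 2 {(Sum.inl Rat.infinitePlace : Place ℚ)}).selmerGroup ≤ selmerGroupRelaxedAtInfinityAtTwo W :=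
    (selmerGroup_kummerStrict_singleton_inl_le_selmerGroup W _).trans
      (Summit.BirchSwinnertonDyer.Rank1Residual.F1Sign2.selmerGroup_le_selmerGroupRelaxedAtInfinityAtTwo W)
  have h := natCard_mul_relIndex_eq_natCard hle
  rw [hidx] at h
  have h' : Nat.card ((kummerStrict W 2 {(Sum.inl Rat.infinitePlace : Place ℚ)}).selmerGroup) * 2 = 4 := h.trans h4
  omega

end Strict

/-! ## §214 `ε = −1`: `#Sel₂(E_K/K) ∈ {4, 8}` over an admissible imaginary quadratic field — the `𝔽₂[Gal(K/ℚ)]`-structure -/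

section Bracket

open Summit.BirchSwinnertonDyer.Rank1Residual.X11b.KummerPT (kummerStrict)

variable (W : WeierstrassCurve ℚ) [W.IsElliptic] [W.IsGloballyMinimal] (K : Type) [Field K] [NumberField K]

/-- **`ε(E) = −1 ⟹ #Sel₂(E_K/K) ∈ {4, 8}`** for `K ∋ √d`, `d` descent-admissible (`Δ > 0`, `E(ℚ)[2] = 0`, rank one, `Ш(E)[2] = 0`; NO hypothesis on
`rank E^{(d)}`, NO finiteness). The map `m ↦ m + σ₀m` on `M = Sel₂(E_K/K)` has KERNEL the `σ₀`-invariants `M^{σ₀} = res_K Sel₂^{rel ∞}(E)`, of order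
`4` (file 50 + file 29), and IMAGE inside `res_K Sel₂^{str ∞}(E)`, of order `≤ 2`: `m + σ₀m = res_K(cor m)` with `cor m` trivial at `∞` (file 48) and in
`Sel₂^{rel ∞}(E)` (file 49). [cite: Kramer1981, Thm. 1, Prop. 7] [cite: SerreGaloisCohomology1997, I §2.4] -/
theorem natCard_selmerGroup_baseChange_two_eq_four_or_eq_eight_of_not_meetsEgg (hΔ : 0 < W.Δ) (hT : NoRationalTwoTorsion W)
    (hrank : W.mordellWeilRank = 1) (hSha : ShaTwoTrivial W) (hegg : ¬ MeetsEgg W) {d : ℤ} (hd : DescAdmissible W d)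
    (h2 : Module.finrank ℚ K = 2) {i : K} (hi : i ^ 2 = (d : K)) :
    Nat.card ((W.baseChange K).selmerGroup ((2 : ℕ) : ℤ)) = 4 ∨ Nat.card ((W.baseChange K).selmerGroup ((2 : ℕ) : ℤ)) = 8 := by
  have hdneg : d < 0 := hd.1
  haveI : (W.baseChange K).IsElliptic := inferInstanceAs ((W.map (algebraMap ℚ K)).IsElliptic)
  haveI : IsGalois ℚ K := isGalois_of_finrank_eq_two K h2
  have hK : ∀ w : InfinitePlace K, w.IsComplex := infinitePlace_isComplex_of_sq_eq_intCast hi hdneg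
  have hθ : i ∉ Set.range (algebraMap ℚ K) := by
    rintro ⟨q, hq⟩
    have hq2 : algebraMap ℚ K (q ^ 2) = algebraMap ℚ K (d : ℚ) := by rw [map_pow, hq, hi, map_intCast]
    have hq2' : q ^ 2 = (d : ℚ) := (algebraMap ℚ K).injective hq2
    have hd' : (d : ℚ) < 0 := by exact_mod_cast hdneg
    nlinarith [sq_nonneg q]
  have hc' : i ^ 2 = algebraMap ℚ K (d : ℚ) := by rw [hi, map_intCast]
  set σ₀ : K ≃ₐ[ℚ] K := sigmaQ K h2 hθ hc' with hσ₀
  have hσ₀1 : σ₀ ≠ 1 := sigmaQ_ne_one K h2 hθ hc'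
  have h2t' : ∀ P : (W.baseChange K).toAffine.Point, ((2 : ℕ) : ℤ) • P = 0 → P = 0 := fun P hP ↦
    Summit.BirchSwinnertonDyer.Rank1Residual.F1Sign2.EggDoubling.eq_zero_of_two_smul_eq_zero_baseChange W hT h2 P
      (by rwa [natCast_zsmul] at hP)
  have hinj := GenusExact.EigenClassesFinite.resTorsion_injective_of_noTorsion W K h2 hθ hc' ((2 : ℕ) : ℤ) h2t'
  set S : AddSubgroup (galH1Torsion (W.baseChange K) ((2 : ℕ) : ℤ)) := (W.baseChange K).selmerGroup ((2 : ℕ) : ℤ) with hS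
  haveI : Finite S := finite_selmerGroup_holds (W.baseChange K) (by norm_num)
  -- the map `m ↦ m + σ₀ m`
  let g : S →+ galH1Torsion (W.baseChange K) ((2 : ℕ) : ℤ) :=
    (AddMonoidHom.id _ + conjAct W σ₀ ((2 : ℕ) : ℤ)).comp S.subtype
  have hg : ∀ m : S, g m = (m : galH1Torsion (W.baseChange K) ((2 : ℕ) : ℤ)) + conjAct W σ₀ _ m := fun m ↦ rfl
  have h2m : ∀ m : galH1Torsion (W.baseChange K) ((2 : ℕ) : ℤ), m + m = 0 := fun m ↦ by
    rw [← two_nsmul, ← natCast_zsmul]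
    exact zsmul_discreteH1_torsion ((2 : ℕ) : ℤ) m
  have hker_iff : ∀ m : S, m ∈ g.ker ↔ conjAct W σ₀ _ (m : galH1Torsion (W.baseChange K) ((2 : ℕ) : ℤ)) = m := by
    intro m
    rw [AddMonoidHom.mem_ker, hg]
    constructor
    · intro h
      have h1 := eq_neg_of_add_eq_zero_right h
      rw [h1, neg_eq_iff_add_eq_zero, h2m]
    · intro h
      rw [h, h2m]
  -- `#S = #ker · #range`
  have hcard : Nat.card S = Nat.card g.ker * Nat.card g.range := by
    rw [← AddSubgroup.index_ker, AddSubgroup.card_mul_index]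
  -- `#ker = #Sel₂^{rel ∞}(W) = 4`
  have hker : Nat.card g.ker = 4 := by
    rw [← natCard_selmerGroupRelaxedAtInfinityAtTwo_eq_four_of_not_meetsEgg W hΔ hT hrank hSha hegg]
    symm
    refine Nat.card_eq_of_bijective
      (fun x : selmerGroupRelaxedAtInfinityAtTwo W ↦
        (⟨⟨resTorsion W K _ x.1, (resTorsion_mem_selmerGroup_iff_mem_selmerGroupRelaxedAtInfinityAtTwo W K hd h2 hi x.1).mpr x.2⟩,
          (hker_iff _).mpr (conjAct_resTorsion K W _ σ₀ h2 hσ₀1 x.1)⟩ : g.ker)) ⟨?_, ?_⟩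
    · intro x y hxy
      exact Subtype.ext (hinj (congrArg (fun z : g.ker ↦ ((z : S) : galH1Torsion (W.baseChange K) ((2 : ℕ) : ℤ))) hxy))
    · rintro ⟨m, hm⟩
      obtain ⟨x, hx, hxm⟩ := (mem_selmerGroup_and_conjAct_eq_iff_exists_mem_relaxed W K hT hd h2 hi hσ₀1 m.1).mp
        ⟨m.2, (hker_iff m).mp hm⟩
      exact ⟨⟨x, hx⟩, Subtype.ext (Subtype.ext hxm)⟩
  -- `#range ≤ #Sel₂^{str ∞}(W) = 2`
  have hstr := natCard_selmerGroup_kummerStrict_inl_eq_two_of_not_meetsEgg W hΔ hT hrank hSha hegg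
  haveI : Finite ((kummerStrict W 2 {(Sum.inl Rat.infinitePlace : Place ℚ)}).selmerGroup) :=
    Nat.finite_of_card_ne_zero (by rw [hstr]; decide)
  haveI : Finite g.range := Finite.of_surjective (fun m : S ↦ (⟨g m, ⟨m, rfl⟩⟩ : g.range))
    (fun z ↦ by obtain ⟨z, m, hm⟩ := z; exact ⟨m, Subtype.ext hm⟩)
  have hlift : ∀ z : g.range, ∃ y : W.galH1Torsion ((2 : ℕ) : ℤ),
      y ∈ (kummerStrict W 2 {(Sum.inl Rat.infinitePlace : Place ℚ)}).selmerGroup ∧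
        resTorsion W K ((2 : ℕ) : ℤ) y = (z : galH1Torsion (W.baseChange K) ((2 : ℕ) : ℤ)) := by
    rintro ⟨z, m, rfl⟩
    obtain ⟨y, hy, hy0⟩ :=
      exists_resTorsion_eq_add_conjAct_and_localization_inl_eq_zero_of_sq_eq_intCast W K h2 hσ₀1 hi hdneg ((2 : ℕ) : ℤ) m
    have hyS : resTorsion W K _ y ∈ S := by
      rw [hy]
      exact S.add_mem m.2 (conjAct_mem_selmerGroup W hK σ₀ _ m.2)
    have hyR := mem_selmerGroupRelaxedAtInfinityAtTwo_of_resTorsion_mem_selmerGroup W K hd h2 hi hyS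
    exact ⟨y, (mem_selmerGroup_kummerStrict_singleton_inl_iff W Rat.infinitePlace y).mpr ⟨hyR, hy0⟩, hy⟩
  have hrange : Nat.card g.range ≤ 2 := by
    refine (Nat.card_le_card_of_injective
      (fun z ↦ (⟨Classical.choose (hlift z), (Classical.choose_spec (hlift z)).1⟩ :
        (kummerStrict W 2 {(Sum.inl Rat.infinitePlace : Place ℚ)}).selmerGroup)) fun z₁ z₂ h ↦ ?_).trans (le_of_eq hstr)
    have h' : Classical.choose (hlift z₁) = Classical.choose (hlift z₂) := congrArg Subtype.val h
    apply Subtype.ext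
    rw [← (Classical.choose_spec (hlift z₁)).2, ← (Classical.choose_spec (hlift z₂)).2, h']
  have hpos : 0 < Nat.card g.range := Nat.card_pos
  rw [hker] at hcard
  interval_cases (Nat.card g.range) <;> omega

/-- **`ε = −1` and `rank E^{(d)}(ℚ) = 2`: `#Sel₂(E_K/K) = 8`** (then `rank E(K) = 3`, the descent count gives `8 ∣ #Sel₂(E_K/K)`, and §214
caps it at `8`; so `Ш(E_K/K)[2] = 0` — the capitulation of nothing, cf. DESC-28-F). [cite: Kramer1981, Thm. 1, Prop. 7] -/
theorem natCard_selmerGroup_baseChange_two_eq_eight_of_not_meetsEgg_of_rank_two (hΔ : 0 < W.Δ) (hT : NoRationalTwoTorsion W)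
    (hrank : W.mordellWeilRank = 1) (hSha : ShaTwoTrivial W) (hegg : ¬ MeetsEgg W) {d : ℤ} (hd : DescAdmissible W d)
    (hrank2 : (W.quadraticTwist (d : ℚ)).mordellWeilRank = 2) (h2 : Module.finrank ℚ K = 2) {i : K} (hi : i ^ 2 = (d : K)) :
    Nat.card ((W.baseChange K).selmerGroup ((2 : ℕ) : ℤ)) = 8 := by
  haveI : (W.baseChange K).IsElliptic := inferInstanceAs ((W.map (algebraMap ℚ K)).IsElliptic)
  have hθ : i ∉ Set.range (algebraMap ℚ K) := by
    rintro ⟨q, hq⟩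
    have hq2 : algebraMap ℚ K (q ^ 2) = algebraMap ℚ K (d : ℚ) := by rw [map_pow, hq, hi, map_intCast]
    have hq2' : q ^ 2 = (d : ℚ) := (algebraMap ℚ K).injective hq2
    have hd' : (d : ℚ) < 0 := by exact_mod_cast hd.1
    nlinarith [sq_nonneg q]
  have hc' : i ^ 2 = algebraMap ℚ K (d : ℚ) := by rw [hi, map_intCast]
  have hrk : (W.baseChange K).mordellWeilRank = 3 := by
    rw [mordellWeilRank_baseChange_eq_add_of_sq_eq W K h2 hθ hc', hrank, hrank2]
  have hcount := card_selmerGroup_eq_pow_rank_mul (W.baseChange K) 2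
  rw [natCard_torsionBy_two_baseChange_eq_one W K hT h2, hrk, mul_one] at hcount
  rcases natCard_selmerGroup_baseChange_two_eq_four_or_eq_eight_of_not_meetsEgg W K hΔ hT hrank hSha hegg hd h2 hi with h | h
  · exfalso
    rw [h] at hcount
    omega
  · exact h

/-- **`ε = −1`, `rank E^{(d)}(ℚ) = 0` and `Ш(E_K/K)[2^∞]` finite: `#Sel₂(E_K/K) = 8`, `#Ш(E_K/K)[2] = 4`** — `#Sel₂ = 2·#Ш[2] ∈ {4, 8}` (§211, §214)
and `#Ш(E_K/K)[2]` is a square (Cassels–Tate, tree `GenusExact.CasselsTateNumberField.isSquare_natCard_sha_torsionBy_pow`), so it is `4`, not `2`: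
the non-trivial class `res_K[x]` of AN-10K is NOT `2`-divisible in `Ш(E_K/K)`. [cite: Kramer1981, Thm. 1, Thm. 2] [cite: Cassels1962ArithmeticIV, §1] -/
theorem natCard_selmerGroup_baseChange_two_eq_eight_of_not_meetsEgg_of_finite (hΔ : 0 < W.Δ) (hT : NoRationalTwoTorsion W)
    (hrank : W.mordellWeilRank = 1) (hSha : ShaTwoTrivial W) (hegg : ¬ MeetsEgg W) {d : ℤ} (hd : DescAdmissible W d)
    (hrank0 : (W.quadraticTwist (d : ℚ)).mordellWeilRank = 0) (h2 : Module.finrank ℚ K = 2) {i : K} (hi : i ^ 2 = (d : K))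
    [Finite (AddCommGroup.primaryComponent (W.baseChange K).sha 2)] :
    Nat.card ((W.baseChange K).selmerGroup ((2 : ℕ) : ℤ)) = 8 ∧
      Nat.card ((W.baseChange K).sha ⊓ AddSubgroup.torsionBy (W.baseChange K).galH1 ((2 : ℕ) : ℕ) : AddSubgroup _) = 4 := by
  haveI : (W.baseChange K).IsElliptic := inferInstanceAs ((W.map (algebraMap ℚ K)).IsElliptic)
  haveI : Fact (Nat.Prime 2) := ⟨Nat.prime_two⟩
  have hmul := natCard_selmerGroup_baseChange_two_eq_two_mul W K hT h2 (mordellWeilRank_baseChange_eq_one W K hrank hd.1 hrank0 h2 hi)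
  have hsq : IsSquare (Nat.card ((W.baseChange K).sha ⊓ AddSubgroup.torsionBy (W.baseChange K).galH1 ((2 : ℕ) : ℕ) : AddSubgroup _)) := by
    rw [natCard_sha_inf_torsionBy_eq]
    have h := GenusExact.CasselsTateNumberField.isSquare_natCard_sha_torsionBy_pow (W.baseChange K) 2 1
    rwa [pow_one] at h
  obtain ⟨r, hr⟩ := hsq
  rcases natCard_selmerGroup_baseChange_two_eq_four_or_eq_eight_of_not_meetsEgg W K hΔ hT hrank hSha hegg hd h2 hi with h | h
  · exfalso
    rw [h, hr] at hmul
    have hr2 : r * r = 2 := by omega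
    have hr1 : r ≤ 1 := by nlinarith
    interval_cases r <;> omega
  · refine ⟨h, ?_⟩
    rw [h] at hmul
    omega

/-- **`ε = −1` at a rank-`0` door: `#Ш(E_K/K)[2] ∈ {2, 4}`** (unconditionally; `4` under finiteness, `…_of_finite`). The non-trivial class is
`res_K[x]`, `x ∈ Sel₂^{rel ∞}(E) ∖ Sel₂(E)` (AN-10K). [cite: Kramer1981, Thm. 1, Prop. 7] -/
theorem natCard_sha_two_baseChange_eq_two_or_eq_four_of_not_meetsEgg (hΔ : 0 < W.Δ) (hT : NoRationalTwoTorsion W)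
    (hrank : W.mordellWeilRank = 1) (hSha : ShaTwoTrivial W) (hegg : ¬ MeetsEgg W) {d : ℤ} (hd : DescAdmissible W d)
    (hrank0 : (W.quadraticTwist (d : ℚ)).mordellWeilRank = 0) (h2 : Module.finrank ℚ K = 2) {i : K} (hi : i ^ 2 = (d : K)) :
    Nat.card ((W.baseChange K).sha ⊓ AddSubgroup.torsionBy (W.baseChange K).galH1 ((2 : ℕ) : ℕ) : AddSubgroup _) = 2 ∨
      Nat.card ((W.baseChange K).sha ⊓ AddSubgroup.torsionBy (W.baseChange K).galH1 ((2 : ℕ) : ℕ) : AddSubgroup _) = 4 := by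
  have hmul := natCard_selmerGroup_baseChange_two_eq_two_mul W K hT h2 (mordellWeilRank_baseChange_eq_one W K hrank hd.1 hrank0 h2 hi)
  rcases natCard_selmerGroup_baseChange_two_eq_four_or_eq_eight_of_not_meetsEgg W K hΔ hT hrank hSha hegg hd h2 hi with h | h <;>
    rw [h] at hmul <;> omega

/-- **`ε = −1` at a rank-`2` door: `Ш(E_K/K)[2] = 0`** — `#Sel₂(E_K/K) = 8 = 2^{rank E(K)}` (`rank E(K) = 3`): the whole `2`-Selmer group over `K`
is the Kummer image, `Ш(E)[2] = 0` stays `0` and the twist's `Ш[2] = 0` too (cf. DESC-28-F at `#Ш(W)[2] = 4`). [cite: Kramer1981, Thm. 1, Prop. 7] -/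
theorem natCard_sha_two_baseChange_eq_one_of_not_meetsEgg_of_rank_two (hΔ : 0 < W.Δ) (hT : NoRationalTwoTorsion W)
    (hrank : W.mordellWeilRank = 1) (hSha : ShaTwoTrivial W) (hegg : ¬ MeetsEgg W) {d : ℤ} (hd : DescAdmissible W d)
    (hrank2 : (W.quadraticTwist (d : ℚ)).mordellWeilRank = 2) (h2 : Module.finrank ℚ K = 2) {i : K} (hi : i ^ 2 = (d : K)) :
    Nat.card ((W.baseChange K).sha ⊓ AddSubgroup.torsionBy (W.baseChange K).galH1 ((2 : ℕ) : ℕ) : AddSubgroup _) = 1 := by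
  haveI : (W.baseChange K).IsElliptic := inferInstanceAs ((W.map (algebraMap ℚ K)).IsElliptic)
  have h8 := natCard_selmerGroup_baseChange_two_eq_eight_of_not_meetsEgg_of_rank_two W K hΔ hT hrank hSha hegg hd hrank2 h2 hi
  have hθ : i ∉ Set.range (algebraMap ℚ K) := by
    rintro ⟨q, hq⟩
    have hq2 : algebraMap ℚ K (q ^ 2) = algebraMap ℚ K (d : ℚ) := by rw [map_pow, hq, hi, map_intCast]
    have hq2' : q ^ 2 = (d : ℚ) := (algebraMap ℚ K).injective hq2
    have hd' : (d : ℚ) < 0 := by exact_mod_cast hd.1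
    nlinarith [sq_nonneg q]
  have hc' : i ^ 2 = algebraMap ℚ K (d : ℚ) := by rw [hi, map_intCast]
  have hrk : (W.baseChange K).mordellWeilRank = 3 := by
    rw [mordellWeilRank_baseChange_eq_add_of_sq_eq W K h2 hθ hc', hrank, hrank2]
  have hcount := card_selmerGroup_eq_pow_rank_mul (W.baseChange K) 2
  rw [natCard_torsionBy_two_baseChange_eq_one W K hT h2, hrk, mul_one, h8] at hcount
  omega

end Bracket

/-! ## §215 DESC-28-G′ `F1Sign2.IdentityGeneratorDoorFieldSelmerCardAtTwo` up to one bit -/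

section DoorFieldPrime

open Summit.BirchSwinnertonDyer.Rank1Residual.F1Sign2 (shaTwoCard IsDoorField fieldSelmerTwoCard)

/-- **DESC-28-G′ up to one bit, unconditionally**: under the exact hypotheses of `F1Sign2.IdentityGeneratorDoorFieldSelmerCardAtTwo` (`Δ_W > 0`,
`E(ℚ)[2] = 0`, rank one, `#Ш(W)[2] = 1`, NO rational point on the egg, `K` a door field), `#Sel₂(W/K) ∈ {4, 8}` (§214 at `d = d_K`). The row's
`= 8` follows when `rank W^{(d_K)} = 2` (§214) or when `rank W^{(d_K)} = 0` and `Ш(W_K/K)[2^∞]` is finite (§214); the remaining bit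
(`#Ш(W_K/K)[2] ≠ 2` at a rank-0 door, `rank W^{(d_K)} ≠ 1`) is Kramer's Thm. 2 / Cassels–Tate. [cite: Kramer1981, Thm. 1, Prop. 7, Thm. 2] -/
theorem fieldSelmerTwoCard_eq_four_or_eq_eight_of_not_meetsEgg (W : WeierstrassCurve ℚ) [W.IsElliptic] [W.IsGloballyMinimal]
    (hΔ : 0 < W.Δ) (hT : NoRationalTwoTorsion W) (hrank : W.mordellWeilRank = 1) (hSha1 : shaTwoCard W = 1) (hegg : ¬ MeetsEgg W)
    (K : Type) [Field K] [NumberField K] (hK : IsDoorField W K) :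
    fieldSelmerTwoCard W K = 4 ∨ fieldSelmerTwoCard W K = 8 := by
  obtain ⟨h2, hd⟩ := hK
  obtain ⟨i, -, hi⟩ := exists_sq_eq_discr_not_mem_range K h2
  have hi' : i ^ 2 = ((NumberField.discr K : ℤ) : K) := by rw [hi, map_intCast]
  exact natCard_selmerGroup_baseChange_two_eq_four_or_eq_eight_of_not_meetsEgg W K hΔ hT hrank
    (shaTwoTrivial_of_shaTwoCard_eq_one W hSha1) hegg hd h2 hi'

/-- **The descent sign in door-field currency**: for `W/ℚ` globally minimal with `Δ_W > 0`, `E(ℚ)[2] = 0`, rank one, `#Ш(W)[2] = 1`, and a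
door field `K` of `W` whose twist `W^{(d_K)}` has rank `0`: `#Sel₂(W/K) = 2 ⟺ E(ℚ) meets the egg` (file 50 §211 at `d = d_K`).
[cite: Kramer1981, Thm. 1, Prop. 6, Prop. 7] -/
theorem fieldSelmerTwoCard_eq_two_iff_meetsEgg (W : WeierstrassCurve ℚ) [W.IsElliptic] [W.IsGloballyMinimal]
    (hΔ : 0 < W.Δ) (hT : NoRationalTwoTorsion W) (hrank : W.mordellWeilRank = 1) (hSha1 : shaTwoCard W = 1)
    (K : Type) [Field K] [NumberField K] (hK : IsDoorField W K)
    (hrank0 : (Summit.BirchSwinnertonDyer.Rank1Residual.F1Sign2.doorTwist W K).mordellWeilRank = 0) :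
    fieldSelmerTwoCard W K = 2 ↔ MeetsEgg W := by
  obtain ⟨h2, hd⟩ := hK
  obtain ⟨i, -, hi⟩ := exists_sq_eq_discr_not_mem_range K h2
  have hi' : i ^ 2 = ((NumberField.discr K : ℤ) : K) := by rw [hi, map_intCast]
  exact natCard_selmerGroup_baseChange_two_eq_two_iff_meetsEgg W K hΔ hT hrank (shaTwoTrivial_of_shaTwoCard_eq_one W hSha1) hd
    hrank0 h2 hi'

end DoorFieldPrime


end Summit.BirchSwinnertonDyer.BirchSwinnertonDyer.Theorems.GenusKolyArch

end
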